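import Mathlib
import Summits.Ventures.PercRepro2.GenTailComp
import Summits.Ventures.PercRepro2.CutSplit
import Summits.Ventures.PercRepro2.TreePack

/-!
# Row B2-TREE on graphs all of whose blocks have at most two disjoint spanning trees
(seat mine-b, cell pub-perc-repro2)

`SpansIn ends E₁ S` says that `S` carries every vertex touched by the part `E₁` to every other
such vertex.  For two parts sharing only a cut vertex `v` (`SharesOnlyVertex`) a walk of
`K ⊆ E₁ ∪ E₂` between two `E₁`-vertices can be shortcut inside `E₁` (`conn_block_of_walk`), so a
set spans the union iff it spans both parts (`spansIn_union_iff_block`), and `k` disjoint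
spanning sets of the union are `k` of each part and conversely (`genIn_spans_block_iff`): the
tree packing number of a block composition is the MINIMUM over the blocks.  With the engine of
`GenTailComp.lean` the class `TreeNet` (parts without three disjoint spanning sets, closed under
gluing at a cut vertex) has a log-concave tree-packing tail (`TreeNet.isLCTail`), i.e. **row
B2-TREE holds for every product measure on every graph all of whose blocks carry at most two
edge-disjoint spanning trees** (`tree_logconcave_of_TreeNet`).
-/

open Finset

namespace Summit.Ventures.PercRepro2

open IFR

section Spanning

variable {V : Type*} {E : Type*} [DecidableEq E]

/-- `u` is an endpoint of an edge of the part -/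
def Touches (ends : E → Sym2 V) (E₁ : Finset E) (u : V) : Prop := ∃ e ∈ E₁, u ∈ ends e

/-- **`S` spans the part `E₁`**: it carries every vertex touched by `E₁` to every other one -/
def SpansIn (ends : E → Sym2 V) (E₁ S : Finset E) : Prop :=
  ∀ u w : V, Touches ends E₁ u → Touches ends E₁ w → Carries ends S u w

/-- spanning a part is increasing in the edge set -/
lemma incr_spansIn (ends : E → Sym2 V) (E₁ : Finset E) : ReimerCube.Incr (SpansIn ends E₁) :=
  fun _ _ h hS u w hu hw => Carries.mono h (hS u w hu hw)

omit [DecidableEq E] in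
/-- a vertex touched by a sub-part is touched by the part -/
lemma Touches.mono {ends : E → Sym2 V} {E₁ E₂ : Finset E} (h : E₁ ⊆ E₂) {u : V}
    (hu : Touches ends E₁ u) : Touches ends E₂ u := by
  obtain ⟨e, he, hue⟩ := hu
  exact ⟨e, h he, hue⟩

/-- spanning a larger part with the empty set spans the smaller part with it -/
lemma not_spansIn_empty_mono {ends : E → Sym2 V} {E₁ E₂ : Finset E} (h : E₁ ⊆ E₂)
    (h₁ : ¬ SpansIn ends E₁ ∅) : ¬ SpansIn ends E₂ ∅ := by
  intro h₂
  exact h₁ fun u w hu hw => h₂ u w (hu.mono h) (hw.mono h)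

/-- an edge with two distinct endpoints makes the empty set non-spanning -/
lemma not_spansIn_empty_of_edge {ends : E → Sym2 V} {E₁ : Finset E} {e : E} (he : e ∈ E₁) {u w : V}
    (hends : ends e = s(u, w)) (huw : u ≠ w) : ¬ SpansIn ends E₁ ∅ := by
  intro h
  have hu : Touches ends E₁ u := ⟨e, he, by rw [hends]; exact Sym2.mem_mk_left u w⟩
  have hw : Touches ends E₁ w := ⟨e, he, by rw [hends]; exact Sym2.mem_mk_right u w⟩
  exact not_carries_empty huw (h u w hu hw)

/-- on the whole edge set, if every vertex is touched, spanning the part is `Spans` -/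
lemma spansIn_univ_eq_spans [Fintype E] {ends : E → Sym2 V} (h : ∀ u : V, Touches ends Finset.univ u) :
    SpansIn ends Finset.univ = Spans ends := by
  funext S
  apply propext
  constructor
  · intro hS u w; exact hS u w (h u) (h w)
  · intro hS u w _ _; exact hS u w

open Classical in
/-- **walks shortcut inside a part**: along a walk of `K ⊆ E₁ ∪ E₂` (parts sharing only `v`),
the `E₁`-projection `φ(y) = y` for `E₁`-vertices, `v` otherwise, moves inside `K ∩ E₁` -/
lemma conn_block_of_walk {ends : E → Sym2 V} {v : V} {E₁ E₂ : Finset E}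
    (hE : SharesOnlyVertex ends v E₁ E₂) {K : Finset E} (hK : K ⊆ E₁ ∪ E₂) :
    ∀ {y x : V} (_w : (openGraph ends (ofFinset K)).Walk y x),
      Conn ends (ofFinset (K ∩ E₁)) (if Touches ends E₁ y then y else v)
        (if Touches ends E₁ x then x else v) := by
  intro y x w
  induction w with
  | nil => exact conn_refl _ _ _
  | @cons y y' _ hadj w' ih =>
    refine conn_trans ?_ ih
    rw [openGraph_adj] at hadj
    obtain ⟨_, e, heopen, heends⟩ := hadj
    have heK : e ∈ K := ofFinset_eq_true_iff.1 heopen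
    have hy : y ∈ ends e := by rw [heends]; exact Sym2.mem_mk_left y y'
    have hy' : y' ∈ ends e := by rw [heends]; exact Sym2.mem_mk_right y y'
    rcases Finset.mem_union.1 (hK heK) with h1 | h2
    · -- an `E₁`-edge: both ends are `E₁`-vertices and the edge lies in `K ∩ E₁`
      have ty : Touches ends E₁ y := ⟨e, h1, hy⟩
      have ty' : Touches ends E₁ y' := ⟨e, h1, hy'⟩
      rw [if_pos ty, if_pos ty']
      exact conn_of_openAdj ⟨e, ofFinset_eq_true_iff.2 (Finset.mem_inter.2 ⟨heK, h1⟩), heends⟩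
    · -- an `E₂`-edge: an end that is also an `E₁`-vertex is `v`
      have key : ∀ z, z ∈ ends e → (if Touches ends E₁ z then z else v) = v := by
        intro z hz
        by_cases tz : Touches ends E₁ z
        · rw [if_pos tz]
          obtain ⟨e₁, he₁, hze₁⟩ := tz
          exact hE e₁ he₁ e h2 z hze₁ hz
        · rw [if_neg tz]
      rw [key y hy, key y' hy']
      exact conn_refl _ _ _

/-- **block composition**: a set inside the union spans the union iff it spans both parts -/
theorem spansIn_union_iff_block {ends : E → Sym2 V} {v : V} {E₁ E₂ : Finset E}
    (hE : SharesOnlyVertex ends v E₁ E₂) (hv₁ : Touches ends E₁ v) (hv₂ : Touches ends E₂ v)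
    {K : Finset E} (hK : K ⊆ E₁ ∪ E₂) :
    SpansIn ends (E₁ ∪ E₂) K ↔ SpansIn ends E₁ (K ∩ E₁) ∧ SpansIn ends E₂ (K ∩ E₂) := by
  classical
  constructor
  · intro h
    constructor
    · intro u w hu hw
      obtain ⟨wk⟩ := h u w (hu.mono Finset.subset_union_left) (hw.mono Finset.subset_union_left)
      have := conn_block_of_walk hE hK wk
      rwa [if_pos hu, if_pos hw] at this
    · intro u w hu hw
      have hK' : K ⊆ E₂ ∪ E₁ := by rw [Finset.union_comm]; exact hK
      obtain ⟨wk⟩ := h u w (hu.mono Finset.subset_union_right) (hw.mono Finset.subset_union_right)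
      have := conn_block_of_walk hE.symm hK' wk
      rwa [if_pos hu, if_pos hw] at this
  · rintro ⟨h₁, h₂⟩ u w hu hw
    have c₁ : ∀ z, Touches ends E₁ z → Carries ends K z v := fun z hz =>
      Carries.mono Finset.inter_subset_left (h₁ z v hz hv₁)
    have c₂ : ∀ z, Touches ends E₂ z → Carries ends K z v := fun z hz =>
      Carries.mono Finset.inter_subset_left (h₂ z v hz hv₂)
    have hv : ∀ z, Touches ends (E₁ ∪ E₂) z → Carries ends K z v := by
      intro z hz
      obtain ⟨e, he, hze⟩ := hz
      rcases Finset.mem_union.1 he with h | h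
      · exact c₁ z ⟨e, h, hze⟩
      · exact c₂ z ⟨e, h, hze⟩
    exact conn_trans (hv u hu) (conn_symm (hv w hw))

/-- restricting `k` disjoint witnesses inside `S ⊆ E₁ ∪ E₂` to a part -/
lemma kDisj_restrict_sub {A B : Finset E → Prop} (hB : ReimerCube.Incr B) {E₁ E₀ : Finset E}
    (h : ∀ T ⊆ E₀, A T → B (T ∩ E₁)) :
    ∀ (k : ℕ) {S : Finset E}, S ⊆ E₀ → kDisj A k S → kDisj B k (S ∩ E₁)
  | 0, _, _, _ => trivial
  | k + 1, S, hS, hSk => by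
      obtain ⟨K, L, hK, hL, hKL, hA, hBk⟩ := hSk
      refine ⟨K ∩ E₁, L ∩ E₁, Finset.inter_subset_inter hK le_rfl, Finset.inter_subset_inter hL le_rfl,
        Finset.disjoint_of_subset_left Finset.inter_subset_left
          (Finset.disjoint_of_subset_right Finset.inter_subset_left hKL), ?_, ?_⟩
      · intro T hT
        exact hB hT (h K (hK.trans hS) (hA K le_rfl))
      · intro T hT
        exact incr_kDisj B k hT (kDisj_restrict_sub hB h k (hL.trans hS) (hBk L le_rfl))

/-- **the tree packing number of a block composition is the minimum over the blocks** -/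
theorem genIn_spans_block_iff [Fintype E] {ends : E → Sym2 V} {v : V} {E₁ E₂ : Finset E}
    (hE : SharesOnlyVertex ends v E₁ E₂) (hv₁ : Touches ends E₁ v) (hv₂ : Touches ends E₂ v)
    (hd : Disjoint E₁ E₂) (k : ℕ) (ω : Config E) :
    ω ∈ genIn (SpansIn ends (E₁ ∪ E₂)) (E₁ ∪ E₂) k ↔
      ω ∈ genIn (SpansIn ends E₁) E₁ k ∧ ω ∈ genIn (SpansIn ends E₂) E₂ k := by
  have h1 : openSet ω ∩ (E₁ ∪ E₂) ∩ E₁ = openSet ω ∩ E₁ := by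
    ext e; simp only [Finset.mem_inter, Finset.mem_union]; tauto
  have h2 : openSet ω ∩ (E₁ ∪ E₂) ∩ E₂ = openSet ω ∩ E₂ := by
    ext e; simp only [Finset.mem_inter, Finset.mem_union]; tauto
  simp only [genIn, Set.mem_setOf_eq]
  constructor
  · intro h
    constructor
    · have := kDisj_restrict_sub (incr_spansIn ends E₁) (E₀ := E₁ ∪ E₂)
        (fun T hT hA => ((spansIn_union_iff_block hE hv₁ hv₂ hT).1 hA).1) k
        Finset.inter_subset_right h
      rwa [h1] at this
    · have := kDisj_restrict_sub (incr_spansIn ends E₂) (E₀ := E₁ ∪ E₂)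
        (fun T hT hA => ((spansIn_union_iff_block hE hv₁ hv₂ hT).1 hA).2) k
        Finset.inter_subset_right h
      rwa [h2] at this
  · rintro ⟨hA, hB⟩
    have hz := kDisj_zip (incr_spansIn ends (E₁ ∪ E₂)) hd
      (fun T₁ T₂ hT₁ hT₂ => by
        intro u w hu hw
        have c₁ : ∀ z, Touches ends E₁ z → Carries ends (T₁ ∪ T₂) z v := fun z hz =>
          Carries.mono Finset.subset_union_left (hT₁ z v hz hv₁)
        have c₂ : ∀ z, Touches ends E₂ z → Carries ends (T₁ ∪ T₂) z v := fun z hz =>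
          Carries.mono Finset.subset_union_right (hT₂ z v hz hv₂)
        have hv : ∀ z, Touches ends (E₁ ∪ E₂) z → Carries ends (T₁ ∪ T₂) z v := by
          intro z hz
          obtain ⟨e, he, hze⟩ := hz
          rcases Finset.mem_union.1 he with h | h
          · exact c₁ z ⟨e, h, hze⟩
          · exact c₂ z ⟨e, h, hze⟩
        exact conn_trans (hv u hu) (conn_symm (hv w hw)))
      k Finset.inter_subset_right Finset.inter_subset_right hA hB
    have hu : openSet ω ∩ E₁ ∪ openSet ω ∩ E₂ = openSet ω ∩ (E₁ ∪ E₂) := by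
      rw [← Finset.inter_union_distrib_left]
    rw [hu] at hz
    exact hz

end Spanning

section Net

variable {V : Type*} {E : Type*} [Fintype E] [DecidableEq E]

/-- **graphs with log-concave tree packing by construction**: parts without three disjoint
spanning sets (and with two distinct touched vertices), glued at cut vertices -/
inductive TreeNet (ends : E → Sym2 V) : Finset E → Prop
  | atom {E₁ : Finset E} (hne : ¬ SpansIn ends E₁ ∅) (h3 : genIn (SpansIn ends E₁) E₁ 3 = ∅) :
      TreeNet ends E₁
  | block {v : V} {E₁ E₂ : Finset E} (hE : SharesOnlyVertex ends v E₁ E₂) (hv₁ : Touches ends E₁ v)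
      (hv₂ : Touches ends E₂ v) (hd : Disjoint E₁ E₂) (h₁ : TreeNet ends E₁) (h₂ : TreeNet ends E₂) :
      TreeNet ends (E₁ ∪ E₂)

/-- the empty set never spans a network of the class -/
theorem TreeNet.not_spansIn_empty {ends : E → Sym2 V} {E₀ : Finset E} (h : TreeNet ends E₀) :
    ¬ SpansIn ends E₀ ∅ := by
  induction h with
  | atom hne _ => exact hne
  | block _ _ _ _ _ _ ih₁ _ => exact not_spansIn_empty_mono Finset.subset_union_left ih₁

/-- **every network of the class has a log-concave tree-packing tail** -/
theorem TreeNet.isLCTail {p : E → ℝ} (hp : IsProbVec p) {ends : E → Sym2 V} {E₀ : Finset E}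
    (h : TreeNet ends E₀) : IsLCTail (genTail p (SpansIn ends E₀) E₀) ((E₀.card : ℤ) + 1) := by
  induction h with
  | @atom E₁ hne h3 => exact isLCTail_genTail_of_no_three hp (incr_spansIn ends E₁) hne E₁ h3
  | @block v E₁ E₂ hE hv₁ hv₂ hd _ _ ih₁ ih₂ =>
    exact isLCTail_genTail_min p (A := SpansIn ends (E₁ ∪ E₂)) (A₁ := SpansIn ends E₁)
      (A₂ := SpansIn ends E₂) hd (genIn_spans_block_iff hE hv₁ hv₂ hd) ih₁ ih₂

/-- **row B2-TREE on every graph all of whose blocks carry at most two edge-disjoint spanning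
trees**: `P(τ ≥ k)·P(τ ≥ k+2) ≤ P(τ ≥ k+1)²` for every product measure -/
theorem tree_logconcave_of_TreeNet {p : E → ℝ} (hp : IsProbVec p) {ends : E → Sym2 V}
    (h : TreeNet ends Finset.univ) (htouch : ∀ u : V, Touches ends Finset.univ u) (k : ℕ) :
    prob p (treeEvent ends k) * prob p (treeEvent ends (k + 2))
      ≤ prob p (treeEvent ends (k + 1)) * prob p (treeEvent ends (k + 1)) := by
  have hk := genIn_logconcave_of_isLCTail (h.isLCTail hp) k
  rw [spansIn_univ_eq_spans htouch] at hk
  exact hk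

end Net

end Summit.Ventures.PercRepro2
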